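import Summits.CriticalPhenomena.PercolationContinuityZ3.Theorems.Transplant.CayleyFreeNilpotentLetters
import Mathlib.Combinatorics.SimpleGraph.Prod
import HarnessLib

/-!
# Products: `Cay(Γ'; S') □ Cay(Γ; S)` has `θ(p_c) = 0` for EVERY finitely generated `Γ'` when `(Γ, S)` carries a `CayleySign₁`

builds on p205010 (kernel theorem, internal audit signed; external expert review pending).
Lane `prim-bschramm`, seat `prim-bschramm-p4` gen 10 (PART C3 of `P4-GENERAL.md`, "tier 2″").  Helper file
(`--supports stmt-CriticalPhenomena-4575 --as helper`).

If `(Γ, S)` carries a `CayleySign₁` (file `CayleySkeletonAdm`) and `Γ'` is any group with a finite symmetric generating set `S'`, then the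
product letters `S' × {1} ∪ {1} × S` carry a `CayleySign₁` on `Γ' × Γ` (skeleton through the second factor; `ν, κ = id × ν, id × κ`; the
kernel `Γ' × ker φ` is generated by the kernel letters `S' × {1}`, `{1} × (S ∩ ker φ)` and the admissible words of the second factor), and
`Cay(Γ' × Γ; S' × {1} ∪ {1} × S) = Cay(Γ'; S') □ Cay(Γ; S)`.  Hence **`θ(p_c) = 0` on `Cay(Γ'; S') □ Cay(Γ; S)`** — in particular on
`Cay(Γ'; S') □ fnGraph (m+2)` for EVERY finitely generated group `Γ'` (the tree's `X □ Cay(N_{m,2})` row, so far modulo `SamePDropOfSkeletonRank`,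
for Cayley graphs `X`; `Γ'` may have intermediate growth).
-/

noncomputable section

namespace Summit.CriticalPhenomena.PercolationContinuityZ3.Theorems.Transplant

open SimpleGraph Literature.Probability.LatticeModels Literature.Probability.Percolation
open scoped Classical

/-- **A `CayleySign₀` with symmetric `S` is a `CayleySign₁`** (kernel letters are admissible generators), so everything below applies to
the data of `CayleySkeletonNoFC` as well. [folklore] -/
def CayleySign₀.toSign₁ {Γ : Type} [Group Γ] {S : Finset Γ} (D : CayleySign₀ Γ S) (hsymm : ∀ s ∈ S, s⁻¹ ∈ S) : CayleySign₁ Γ S where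
  φ := D.φ
  map_mul := D.map_mul
  lip := D.lip
  step := D.step
  inv_mem := hsymm
  ν := D.ν
  ν_mem := D.ν_mem
  ν_φ := D.ν_φ
  ker_adm := fun σ _ k hk =>
    Subgroup.closure_mono (fun g hg => Or.inl (by simpa [Finset.coe_filter] using hg)) (D.ker_gen k hk)
  κ := D.κ
  κ_mem := D.κ_mem
  κ_φ := D.κ_φ

namespace CayleySign₁

variable {Γ : Type} [Group Γ] {S : Finset Γ} (D : CayleySign₁ Γ S)
variable {Γ' : Type} [Group Γ'] (S' : Finset Γ')

/-- **The product letters** `S' × {1} ∪ {1} × S`. [folklore] -/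
def prodS (S' : Finset Γ') (S : Finset Γ) : Finset (Γ' × Γ) := S'.image (fun s => (s, 1)) ∪ S.image (fun s => (1, s))

/-- Membership in the product letters. [folklore] -/
theorem mem_prodS {z : Γ' × Γ} : z ∈ prodS S' S ↔ (∃ s ∈ S', z = (s, 1)) ∨ ∃ s ∈ S, z = (1, s) := by
  simp only [prodS, Finset.mem_union, Finset.mem_image]
  constructor
  · rintro (⟨s, hs, rfl⟩ | ⟨s, hs, rfl⟩)
    · exact Or.inl ⟨s, hs, rfl⟩
    · exact Or.inr ⟨s, hs, rfl⟩
  · rintro (⟨s, hs, rfl⟩ | ⟨s, hs, rfl⟩)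
    · exact Or.inl ⟨s, hs, rfl⟩
    · exact Or.inr ⟨s, hs, rfl⟩

variable {S'}

/-- An automorphism `id × α` with `α` preserving `S` preserves the product letters. [folklore] -/
theorem prodCongr_mem_prodS (α : Γ ≃* Γ) (hα : ∀ s, α s ∈ S ↔ s ∈ S) (z : Γ' × Γ) :
    (MulEquiv.refl Γ').prodCongr α z ∈ prodS S' S ↔ z ∈ prodS S' S := by
  obtain ⟨a, b⟩ := z
  change (a, α b) ∈ prodS S' S ↔ (a, b) ∈ prodS S' S
  rw [mem_prodS, mem_prodS]
  constructor
  · rintro (⟨s, hs, h⟩ | ⟨s, hs, h⟩)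
    · obtain ⟨rfl, hb⟩ := Prod.mk.inj h
      have : b = 1 := by rwa [map_eq_one_iff α (EquivLike.injective α)] at hb
      subst this; exact Or.inl ⟨a, hs, rfl⟩
    · obtain ⟨rfl, hb⟩ := Prod.mk.inj h
      exact Or.inr ⟨b, (hα b).1 (hb ▸ hs), rfl⟩
  · rintro (⟨s, hs, h⟩ | ⟨s, hs, h⟩)
    · obtain ⟨rfl, rfl⟩ := Prod.mk.inj h
      exact Or.inl ⟨a, hs, by rw [map_one]⟩
    · obtain ⟨rfl, rfl⟩ := Prod.mk.inj h
      exact Or.inr ⟨α b, (hα b).2 hs, rfl⟩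

/-- **THE PRODUCT DATUM**: `(Γ' × Γ, S' × {1} ∪ {1} × S)` carries a `CayleySign₁` whenever `(Γ, S)` does and `S'` is a finite symmetric
generating set of `Γ'`. [cite: KozmaNitzan2024, §4 p. 16 (Lemma 8)] [cite: BenjaminiSchramm1996, §2] -/
def prod (hsymm : ∀ s ∈ S', s⁻¹ ∈ S') (hgen : Subgroup.closure (S' : Set Γ') = ⊤) : CayleySign₁ (Γ' × Γ) (prodS S' S) where
  φ := fun z => D.φ z.2
  map_mul := fun g h => D.map_mul g.2 h.2
  lip := fun z hz i => by
    rcases (mem_prodS S').1 hz with ⟨s, -, rfl⟩ | ⟨s, hs, rfl⟩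
    · change |D.φ 1 i| ≤ 1; rw [D.toCayleyNeg₁.φ_one]; simp
    · exact D.lip s hs i
  step := fun i => by
    obtain ⟨s, hs, h⟩ := D.step i
    exact ⟨(1, s), (mem_prodS S').2 (Or.inr ⟨s, hs, rfl⟩), h⟩
  inv_mem := fun z hz => by
    rcases (mem_prodS S').1 hz with ⟨s, hs, rfl⟩ | ⟨s, hs, rfl⟩
    · exact (mem_prodS S').2 (Or.inl ⟨s⁻¹, hsymm s hs, by simp⟩)
    · exact (mem_prodS S').2 (Or.inr ⟨s⁻¹, D.inv_mem s hs, by simp⟩)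
  ν := (MulEquiv.refl Γ').prodCongr D.ν
  ν_mem := prodCongr_mem_prodS D.ν D.ν_mem
  ν_φ := fun g => D.ν_φ g.2
  ker_adm := fun σ hσ k hk => by
    -- the admissible generators of the second factor embed, the letters of the first factor are kernel letters
    set A := CayCyl.admGen (fun z : Γ' × Γ => D.φ z.2) (prodS S' S) σ with hA
    have h1 : (MonoidHom.inl Γ' Γ) k.1 ∈ Subgroup.closure A := by
      have hk1 : k.1 ∈ Subgroup.closure (S' : Set Γ') := by rw [hgen]; exact Subgroup.mem_top _
      have := Subgroup.mem_map_of_mem (MonoidHom.inl Γ' Γ) hk1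
      rw [MonoidHom.map_closure] at this
      refine Subgroup.closure_mono ?_ this
      rintro _ ⟨s, hs, rfl⟩
      exact Or.inl ⟨(mem_prodS S').2 (Or.inl ⟨s, Finset.mem_coe.1 hs, rfl⟩), D.toCayleyNeg₁.φ_one⟩
    have h2 : (MonoidHom.inr Γ' Γ) k.2 ∈ Subgroup.closure A := by
      have := Subgroup.mem_map_of_mem (MonoidHom.inr Γ' Γ) (D.ker_adm σ hσ k.2 hk)
      rw [MonoidHom.map_closure] at this
      refine Subgroup.closure_mono ?_ this
      rintro _ ⟨g, hg, rfl⟩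
      rcases hg with ⟨hgS, hg0⟩ | ⟨a, ha, b, hb, hda, hdb, hne, rfl⟩
      · exact Or.inl ⟨(mem_prodS S').2 (Or.inr ⟨g, hgS, rfl⟩), hg0⟩
      · refine Or.inr ⟨(1, a), (mem_prodS S').2 (Or.inr ⟨a, ha, rfl⟩), (1, b), (mem_prodS S').2 (Or.inr ⟨b, hb, rfl⟩),
          hda, hdb, hne, ?_⟩
        simp [MonoidHom.inr_apply]
    have e : k = (MonoidHom.inl Γ' Γ) k.1 * (MonoidHom.inr Γ' Γ) k.2 := by simp
    rw [e]
    exact Subgroup.mul_mem _ h1 h2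
  κ := (MulEquiv.refl Γ').prodCongr D.κ
  κ_mem := prodCongr_mem_prodS D.κ D.κ_mem
  κ_φ := fun g => D.κ_φ g.2

/-- Which differences are product letters. [folklore] -/
theorem inv_mul_mem_prodS_iff (x y : Γ' × Γ) :
    x⁻¹ * y ∈ prodS S' S ↔ (x.1⁻¹ * y.1 ∈ S' ∧ x.2 = y.2) ∨ (x.1 = y.1 ∧ x.2⁻¹ * y.2 ∈ S) := by
  rw [mem_prodS]
  constructor
  · rintro (⟨s, hs, h⟩ | ⟨s, hs, h⟩) <;> rw [Prod.ext_iff] at h <;>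
      simp only [Prod.fst_mul, Prod.fst_inv, Prod.snd_mul, Prod.snd_inv] at h
    · refine Or.inl ⟨by rw [h.1]; exact hs, inv_mul_eq_one.1 h.2⟩
    · refine Or.inr ⟨inv_mul_eq_one.1 h.1, by rw [h.2]; exact hs⟩
  · rintro (⟨h1, h2⟩ | ⟨h1, h2⟩)
    · exact Or.inl ⟨_, h1, Prod.ext rfl (by simp [h2])⟩
    · exact Or.inr ⟨_, h2, Prod.ext (by simp [h1]) rfl⟩

/-- **The Cayley graph of the product letters is the box product** `Cay(Γ'; S') □ Cay(Γ; S)`. [folklore] -/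
theorem mulCayley_prodS : mulCayley (↑(prodS S' S) : Set (Γ' × Γ)) = mulCayley (S' : Set Γ') □ mulCayley (S : Set Γ) := by
  ext x y
  simp only [mulCayley_adj, boxProd_adj, Finset.mem_coe, inv_mul_mem_prodS_iff, ne_eq, Prod.ext_iff]
  tauto

include D in
/-- **THEOREM: `θ_g(p_c) = 0` on `Cay(Γ'; S') □ Cay(Γ; S)`** for every group `Γ'` with a finite symmetric generating set `S'` and every
`(Γ, S)` carrying a `CayleySign₁` (`Γ'` arbitrary: intermediate growth allowed). builds on p205010 (kernel theorem, internal audit signed;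
external expert review pending). [cite: BenjaminiSchramm1996, Conj. 4; §2] [cite: KozmaNitzan2024, §1 p. 2 (approach 1)] -/
theorem criticalContinuity_boxProd (hsymm : ∀ s ∈ S', s⁻¹ ∈ S') (hgen : Subgroup.closure (S' : Set Γ') = ⊤) (g : Γ' × Γ) :
    theta (mulCayley (S' : Set Γ') □ mulCayley (S : Set Γ)) g
      (criticalProbIOf (mulCayley (S' : Set Γ') □ mulCayley (S : Set Γ)) g) = 0 := by
  have h := (D.prod hsymm hgen).theta_eq_zero_of_le g (p := criticalProbIOf (mulCayley (↑(prodS S' S) : Set (Γ' × Γ))) g) le_rfl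
  rw [mulCayley_prodS] at h
  exact h

end CayleySign₁

/-- **COROLLARY: `θ(p_c) = 0` on `Cay(Γ'; S') □ fnGraph (m+2)`** for every finitely generated group `Γ'` (finite symmetric generating set
`S'`) and every `m` — the product of an ARBITRARY Cayley graph with the letters-only Cayley graph of `N_{m+2,2}`.
builds on p205010 (kernel theorem, internal audit signed; external expert review pending). [cite: BenjaminiSchramm1996, Conj. 4] -/
theorem FreeNilLetters.boxProd_fn_criticalContinuity {Γ' : Type} [Group Γ'] {S' : Finset Γ'} (hsymm : ∀ s ∈ S', s⁻¹ ∈ S')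
    (hgen : Subgroup.closure (S' : Set Γ') = ⊤) (m : ℕ) (v : Γ' × FN (m + 2)) :
    theta (mulCayley (S' : Set Γ') □ fnGraph (m + 2)) v (criticalProbIOf (mulCayley (S' : Set Γ') □ fnGraph (m + 2)) v) = 0 := by
  have h := CayleySign₁.criticalContinuity_boxProd (FreeNilLetters.cayleySign₁ m) hsymm hgen v
  rw [FreeNilLetters.mulCayley_Sg_eq] at h
  exact h

end Summit.CriticalPhenomena.PercolationContinuityZ3.Theorems.Transplant

end
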